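import Mathlib
import HarnessLib
import Summits.Langlands.Langlands.Theses.E8QuinticResidue

noncomputable section

open scoped NumberField
open IsDedekindDomain Field Polynomial Filter
open Literature.NumberTheory.GaloisRepresentations Literature.NumberTheory.Automorphic

set_option linter.dupNamespace false

/-!
# Birth skeleton of piece X2 `ShadowSignLaw` (child of NoChimeras, stmt-Langlands-11145) — BC3

Two stubs and a real composition:
* `stub_signIsQuadraticResidue` (S2a) — the sign between `π` and an icosahedral shadow `σ₀` is, off
  the `λ = 0` places and a finite set, either identically `+1` or the Legendre-type symbol of a
  quadratic field `L` (`e_v = -1 ↔ v` inert in `L`): ShadowSignLaw with the character made EXPLICIT (its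
  attack surface: the sign set must have density `½` among `λ ≠ 0` places and be multiplicative);
* `stub_quadraticCharacterRealisation` (S2b) — the quadratic Artin character of `L/ℚ` as a
  continuous `χ : Γ_ℚ →ₜ* ℂˣ`, trivial on inertia and `= -1` exactly on the Frobenii at inert `v`,
  a.e. (class field theory for quadratic fields; provable, support-grade);
* `ShadowSignLaw_of : S2a → S2b → ShadowSignLaw` — dichotomy: trivial character in the first case; in the second,
  at `λ ≠ 0` places the two signs agree by the inertness criterion, and at `λ = 0` places
  `α = {x, -x}` so `satakePolynomial (e • α)` does not see the sign.
-/

namespace Summit.Langlands.Langlands.Cruxes.ShadowSignLaw.Birth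

/-- Stub S2a — the sign is a quadratic residue symbol (or trivial) a.e. off `λ = 0`.
[cite: Ramakrishnan2000, Thm. 4.1.1] -/
theorem stub_signIsQuadraticResidue : ∀ (hcpt : Literature.NumberTheory.Automorphic.isCompact_glFiniteIntegralLevel 2 ℚ) (π π' : Literature.NumberTheory.Automorphic.CuspidalAutomorphicRepData 2 ℚ hcpt), ¬ π.1.IsNearlyEquivalent π'.1 → (∀ (K : Type) [Field K] [NumberField K], Module.finrank ℚ K = 2 → ¬ ∀ᶠ v : IsDedekindDomain.HeightOneSpectrum (NumberField.RingOfIntegers ℚ) in Filter.cofinite, (Ideal.span {((v.residueCard : ℕ) : NumberField.RingOfIntegers K)}).IsPrime → ∀ α : Multiset ℂ, π.1.HasSatakeParamAt v α → π.1.HasSatakeParamAt v (α.map fun a => -a)) → (∀ (K : Type) [Field K] [NumberField K], Module.finrank ℚ K = 2 → ¬ ∀ᶠ v : IsDedekindDomain.HeightOneSpectrum (NumberField.RingOfIntegers ℚ) in Filter.cofinite, (Ideal.span {((v.residueCard : ℕ) : NumberField.RingOfIntegers K)}).IsPrime → ∀ α : Multiset ℂ, π'.1.HasSatakeParamAt v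 α → π'.1.HasSatakeParamAt v (α.map fun a => -a)) → (∀ᶠ v : IsDedekindDomain.HeightOneSpectrum (NumberField.RingOfIntegers ℚ) in Filter.cofinite, ∃ α α' : Multiset ℂ, π.1.HasSatakeParamAt v α ∧ π'.1.HasSatakeParamAt v α' ∧ α.prod = 1 ∧ α'.prod = 1 ∧ ∃ a b : ℤ, α.sum = (a : ℂ) + (b : ℂ) * ((1 + (Real.sqrt 5 : ℂ)) / 2) ∧ α'.sum = (a : ℂ) + (b : ℂ) * ((1 - (Real.sqrt 5 : ℂ)) / 2) ∧ ((b = 0 ∧ (a = 0 ∨ a = 1 ∨ a = -1 ∨ a = 2 ∨ a = -2)) ∨ (b = 1 ∧ (a = 0 ∨ a = -1)) ∨ (b = -1 ∧ (a = 0 ∨ a = 1)))) → (∀ᶠ v : IsDedekindDomain.HeightOneSpectrum (NumberField.RingOfIntegers ℚ) in Filter.cofinite, (∀ α : Multiset ℂ, π.1.HasSatakeParamAt v α → ∀ a ∈ α, ‖a‖ = 1) ∧ (∀ α' : Multiset ℂ, π'.1.HasSatakeParamAt v α' → ∀ a ∈ α', ‖a‖ = 1)) → ∀ σ₀ : Literature.NumberTheory.GaloisRepresentations.FramedGaloisRep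 ℚ ℂ 2, σ₀.toGaloisRep.IsIrreducible → Nonempty ((Matrix.ProjGenLinGroup.mk.comp σ₀.toMonoidHom).range ≃* alternatingGroup (Fin 5)) → (∀ᶠ v : IsDedekindDomain.HeightOneSpectrum (NumberField.RingOfIntegers ℚ) in Filter.cofinite, ∃ α : Multiset ℂ, π.1.HasSatakeParamAt v α ∧ σ₀.IsUnramifiedAt v ∧ ∃ e : ℂ, e ^ 2 = 1 ∧ σ₀.HasFrobCharpolyAt v (Literature.NumberTheory.Automorphic.satakePolynomial (α.map fun a => e * a))) → (∀ᶠ v : IsDedekindDomain.HeightOneSpectrum (NumberField.RingOfIntegers ℚ) in Filter.cofinite, ∃ α : Multiset ℂ, π.1.HasSatakeParamAt v α ∧ σ₀.IsUnramifiedAt v ∧ σ₀.HasFrobCharpolyAt v (Literature.NumberTheory.Automorphic.satakePolynomial α)) ∨ (∃ (L : Type) (_ : Field L) (_ : NumberField L), Module.finrank ℚ L = 2 ∧ ∀ᶠ v : IsDedekindDomain.HeightOneSpectrum (NumberField.RingOfIntegers ℚ) in Filter.cofinite, ∃ α : Multiset ℂ, π.1.HasSatakeParamAt v α ∧ σ₀.IsUnramifiedAt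 v ∧ ∃ e : ℂ, e ^ 2 = 1 ∧ σ₀.HasFrobCharpolyAt v (Literature.NumberTheory.Automorphic.satakePolynomial (α.map fun a => e * a)) ∧ (α.sum ≠ 0 → (e = -1 ↔ (Ideal.span {((v.residueCard : ℕ) : NumberField.RingOfIntegers L)}).IsPrime))) := by
  sorry

/-- Stub S2b — the quadratic Artin character of a quadratic field, realised continuously on `Γ_ℚ`
with its inertia/Frobenius behaviour at a.e. place. [cite: SerreLocalFields1979, Ch. I §8] -/
theorem stub_quadraticCharacterRealisation : ∀ (L : Type) [Field L] [NumberField L], Module.finrank ℚ L = 2 → ∃ χ : Field.absoluteGaloisGroup ℚ →ₜ* ℂˣ, ∀ᶠ v : IsDedekindDomain.HeightOneSpectrum (NumberField.RingOfIntegers ℚ) in Filter.cofinite, (∀ 𝔓 ∈ v.primesAbove, ∀ g ∈ 𝔓.inertia (Field.absoluteGaloisGroup ℚ), χ g = 1) ∧ ∃ e : ℂ, e ^ 2 = 1 ∧ (∀ 𝔓 ∈ v.primesAbove, ∀ g : Field.absoluteGaloisGroup ℚ, IsArithFrobAt (NumberField.RingOfIntegers ℚ) g 𝔓 → ((χ g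 : ℂˣ) : ℂ) = e) ∧ (e = -1 ↔ (Ideal.span {((v.residueCard : ℕ) : NumberField.RingOfIntegers L)}).IsPrime) := by
  sorry

/-- If `∑ α = 0` and `card α = 2` then `α` is symmetric: `(-e) • α = e • α`. [folklore] -/
theorem map_neg_mul_eq_of_sum_eq_zero {α : Multiset ℂ} (hc : Multiset.card α = 2) (hs : α.sum = 0)
    (e : ℂ) : (α.map fun a => -e * a) = α.map fun a => e * a := by
  obtain ⟨x, y, rfl⟩ := Multiset.card_eq_two.mp hc
  simp only [Multiset.insert_eq_cons, Multiset.sum_cons, Multiset.sum_singleton] at hs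
  have hy : y = -x := by linear_combination hs
  subst hy
  simp only [Multiset.insert_eq_cons, Multiset.map_cons, Multiset.map_singleton]
  rw [show -e * x = e * -x by ring, show -e * -x = e * x by ring]
  exact Multiset.cons_swap (e * -x) (e * x) 0

/-- Square roots of one are `±1`. [folklore] -/
theorem eq_or_eq_neg_of_sq_eq_one {e : ℂ} (he : e ^ 2 = 1) : e = 1 ∨ e = -1 := by
  have h : (e - 1) * (e + 1) = 0 := by linear_combination he
  rcases mul_eq_zero.mp h with h1 | h1
  · left; linear_combination h1
  · right; linear_combination h1

/-- **X2 from S2a and S2b.** -/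
theorem ShadowSignLaw_of : (∀ (hcpt : Literature.NumberTheory.Automorphic.isCompact_glFiniteIntegralLevel 2 ℚ) (π π' : Literature.NumberTheory.Automorphic.CuspidalAutomorphicRepData 2 ℚ hcpt), ¬ π.1.IsNearlyEquivalent π'.1 → (∀ (K : Type) [Field K] [NumberField K], Module.finrank ℚ K = 2 → ¬ ∀ᶠ v : IsDedekindDomain.HeightOneSpectrum (NumberField.RingOfIntegers ℚ) in Filter.cofinite, (Ideal.span {((v.residueCard : ℕ) : NumberField.RingOfIntegers K)}).IsPrime → ∀ α : Multiset ℂ, π.1.HasSatakeParamAt v α → π.1.HasSatakeParamAt v (α.map fun a => -a)) → (∀ (K : Type) [Field K] [NumberField K], Module.finrank ℚ K = 2 → ¬ ∀ᶠ v : IsDedekindDomain.HeightOneSpectrum (NumberField.RingOfIntegers ℚ) in Filter.cofinite, (Ideal.span {((v.residueCard : ℕ) : NumberField.RingOfIntegers K)}).IsPrime → ∀ α : Multiset ℂ, π'.1.HasSatakeParamAt v α → π'.1.HasSatakeParamAt v (α.map fun a => -a)) → (∀ᶠ v : IsDedekindDomain.HeightOneSpectrum (NumberField.RingOfIntegers ℚ)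 in Filter.cofinite, ∃ α α' : Multiset ℂ, π.1.HasSatakeParamAt v α ∧ π'.1.HasSatakeParamAt v α' ∧ α.prod = 1 ∧ α'.prod = 1 ∧ ∃ a b : ℤ, α.sum = (a : ℂ) + (b : ℂ) * ((1 + (Real.sqrt 5 : ℂ)) / 2) ∧ α'.sum = (a : ℂ) + (b : ℂ) * ((1 - (Real.sqrt 5 : ℂ)) / 2) ∧ ((b = 0 ∧ (a = 0 ∨ a = 1 ∨ a = -1 ∨ a = 2 ∨ a = -2)) ∨ (b = 1 ∧ (a = 0 ∨ a = -1)) ∨ (b = -1 ∧ (a = 0 ∨ a = 1)))) → (∀ᶠ v : IsDedekindDomain.HeightOneSpectrum (NumberField.RingOfIntegers ℚ) in Filter.cofinite, (∀ α : Multiset ℂ, π.1.HasSatakeParamAt v α → ∀ a ∈ α, ‖a‖ = 1) ∧ (∀ α' : Multiset ℂ, π'.1.HasSatakeParamAt v α' → ∀ a ∈ α', ‖a‖ = 1)) → ∀ σ₀ : Literature.NumberTheory.GaloisRepresentations.FramedGaloisRep ℚ ℂ 2, σ₀.toGaloisRep.IsIrreducible → Nonempty ((Matrix.ProjGenLinGroup.mk.comp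 σ₀.toMonoidHom).range ≃* alternatingGroup (Fin 5)) → (∀ᶠ v : IsDedekindDomain.HeightOneSpectrum (NumberField.RingOfIntegers ℚ) in Filter.cofinite, ∃ α : Multiset ℂ, π.1.HasSatakeParamAt v α ∧ σ₀.IsUnramifiedAt v ∧ ∃ e : ℂ, e ^ 2 = 1 ∧ σ₀.HasFrobCharpolyAt v (Literature.NumberTheory.Automorphic.satakePolynomial (α.map fun a => e * a))) → (∀ᶠ v : IsDedekindDomain.HeightOneSpectrum (NumberField.RingOfIntegers ℚ) in Filter.cofinite, ∃ α : Multiset ℂ, π.1.HasSatakeParamAt v α ∧ σ₀.IsUnramifiedAt v ∧ σ₀.HasFrobCharpolyAt v (Literature.NumberTheory.Automorphic.satakePolynomial α)) ∨ (∃ (L : Type) (_ : Field L) (_ : NumberField L), Module.finrank ℚ L = 2 ∧ ∀ᶠ v : IsDedekindDomain.HeightOneSpectrum (NumberField.RingOfIntegers ℚ) in Filter.cofinite, ∃ α : Multiset ℂ, π.1.HasSatakeParamAt v α ∧ σ₀.IsUnramifiedAt v ∧ ∃ e : ℂ, e ^ 2 = 1 ∧ σ₀.HasFrobCharpolyAt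 v (Literature.NumberTheory.Automorphic.satakePolynomial (α.map fun a => e * a)) ∧ (α.sum ≠ 0 → (e = -1 ↔ (Ideal.span {((v.residueCard : ℕ) : NumberField.RingOfIntegers L)}).IsPrime)))) → (∀ (L : Type) [Field L] [NumberField L], Module.finrank ℚ L = 2 → ∃ χ : Field.absoluteGaloisGroup ℚ →ₜ* ℂˣ, ∀ᶠ v : IsDedekindDomain.HeightOneSpectrum (NumberField.RingOfIntegers ℚ) in Filter.cofinite, (∀ 𝔓 ∈ v.primesAbove, ∀ g ∈ 𝔓.inertia (Field.absoluteGaloisGroup ℚ), χ g = 1) ∧ ∃ e : ℂ, e ^ 2 = 1 ∧ (∀ 𝔓 ∈ v.primesAbove, ∀ g : Field.absoluteGaloisGroup ℚ, IsArithFrobAt (NumberField.RingOfIntegers ℚ) g 𝔓 → ((χ g : ℂˣ) : ℂ) = e) ∧ (e = -1 ↔ (Ideal.span {((v.residueCard : ℕ) : NumberField.RingOfIntegers L)}).IsPrime)) → (∀ (hcpt : Literature.NumberTheory.Automorphic.isCompact_glFiniteIntegralLevel 2 ℚ) (π π' : Literature.NumberTheory.Automorphic.CuspidalAutomorphicRepData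 2 ℚ hcpt), ¬ π.1.IsNearlyEquivalent π'.1 → (∀ (K : Type) [Field K] [NumberField K], Module.finrank ℚ K = 2 → ¬ ∀ᶠ v : IsDedekindDomain.HeightOneSpectrum (NumberField.RingOfIntegers ℚ) in Filter.cofinite, (Ideal.span {((v.residueCard : ℕ) : NumberField.RingOfIntegers K)}).IsPrime → ∀ α : Multiset ℂ, π.1.HasSatakeParamAt v α → π.1.HasSatakeParamAt v (α.map fun a => -a)) → (∀ (K : Type) [Field K] [NumberField K], Module.finrank ℚ K = 2 → ¬ ∀ᶠ v : IsDedekindDomain.HeightOneSpectrum (NumberField.RingOfIntegers ℚ) in Filter.cofinite, (Ideal.span {((v.residueCard : ℕ) : NumberField.RingOfIntegers K)}).IsPrime → ∀ α : Multiset ℂ, π'.1.HasSatakeParamAt v α → π'.1.HasSatakeParamAt v (α.map fun a => -a)) → (∀ᶠ v : IsDedekindDomain.HeightOneSpectrum (NumberField.RingOfIntegers ℚ) in Filter.cofinite, ∃ α α' : Multiset ℂ, π.1.HasSatakeParamAt v α ∧ π'.1.HasSatakeParamAt v α' ∧ α.prod = 1 ∧ α'.prod = 1 ∧ ∃ a b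 : ℤ, α.sum = (a : ℂ) + (b : ℂ) * ((1 + (Real.sqrt 5 : ℂ)) / 2) ∧ α'.sum = (a : ℂ) + (b : ℂ) * ((1 - (Real.sqrt 5 : ℂ)) / 2) ∧ ((b = 0 ∧ (a = 0 ∨ a = 1 ∨ a = -1 ∨ a = 2 ∨ a = -2)) ∨ (b = 1 ∧ (a = 0 ∨ a = -1)) ∨ (b = -1 ∧ (a = 0 ∨ a = 1)))) → (∀ᶠ v : IsDedekindDomain.HeightOneSpectrum (NumberField.RingOfIntegers ℚ) in Filter.cofinite, (∀ α : Multiset ℂ, π.1.HasSatakeParamAt v α → ∀ a ∈ α, ‖a‖ = 1) ∧ (∀ α' : Multiset ℂ, π'.1.HasSatakeParamAt v α' → ∀ a ∈ α', ‖a‖ = 1)) → ∀ σ₀ : Literature.NumberTheory.GaloisRepresentations.FramedGaloisRep ℚ ℂ 2, σ₀.toGaloisRep.IsIrreducible → Nonempty ((Matrix.ProjGenLinGroup.mk.comp σ₀.toMonoidHom).range ≃* alternatingGroup (Fin 5)) → (∀ᶠ v : IsDedekindDomain.HeightOneSpectrum (NumberField.RingOfIntegers ℚ) in Filter.cofinite,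 ∃ α : Multiset ℂ, π.1.HasSatakeParamAt v α ∧ σ₀.IsUnramifiedAt v ∧ ∃ e : ℂ, e ^ 2 = 1 ∧ σ₀.HasFrobCharpolyAt v (Literature.NumberTheory.Automorphic.satakePolynomial (α.map fun a => e * a))) → ∃ χ : Field.absoluteGaloisGroup ℚ →ₜ* ℂˣ, ∀ᶠ v : IsDedekindDomain.HeightOneSpectrum (NumberField.RingOfIntegers ℚ) in Filter.cofinite, ∃ α : Multiset ℂ, π.1.HasSatakeParamAt v α ∧ σ₀.IsUnramifiedAt v ∧ (∀ 𝔓 ∈ v.primesAbove, ∀ g ∈ 𝔓.inertia (Field.absoluteGaloisGroup ℚ), χ g = 1) ∧ ∃ e : ℂ, e ^ 2 = 1 ∧ (∀ 𝔓 ∈ v.primesAbove, ∀ g : Field.absoluteGaloisGroup ℚ, IsArithFrobAt (NumberField.RingOfIntegers ℚ) g 𝔓 → ((χ g : ℂˣ) : ℂ) = e) ∧ σ₀.HasFrobCharpolyAt v (Literature.NumberTheory.Automorphic.satakePolynomial (α.map fun a => e * a))) := by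
  intro hA hB hcpt π π' hne hnd hnd' hAl hT σ₀ hirr hico hM
  rcases hA hcpt π π' hne hnd hnd' hAl hT σ₀ hirr hico hM with hplus | ⟨L, iF, iN, hL2, hLs⟩
  · -- the sign is a.e. +1: the trivial character
    refine ⟨1, ?_⟩
    filter_upwards [hplus] with v hv
    obtain ⟨α, hα, hur, hcp⟩ := hv
    refine ⟨α, hα, hur, fun 𝔓 _ g _ => rfl, 1, one_pow 2, fun 𝔓 _ g _ => ?_, ?_⟩
    · rw [ContinuousMonoidHom.coe_one, Pi.one_apply, Units.val_one]
    · have hmap : (α.map fun a => (1 : ℂ) * a) = α := by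
        rw [Multiset.map_congr rfl fun a _ => one_mul a, Multiset.map_id']
      rw [hmap]
      exact hcp
  · -- the sign is the quadratic symbol of L: take its Artin character
    letI := iF
    letI := iN
    obtain ⟨χ, hχ⟩ := hB L hL2
    refine ⟨χ, ?_⟩
    filter_upwards [hLs, hχ] with v hv hv'
    obtain ⟨α, hα, hur, e, he, hcp, hsign⟩ := hv
    obtain ⟨hχur, e', he', hχe', hsign'⟩ := hv'
    refine ⟨α, hα, hur, hχur, e', he', hχe', ?_⟩
    by_cases hs : α.sum = 0
    · -- λ = 0 : the Satake polynomial does not see the sign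
      rcases eq_or_eq_neg_of_sq_eq_one he with rfl | rfl <;>
        rcases eq_or_eq_neg_of_sq_eq_one he' with rfl | rfl
      · exact hcp
      · rw [show (fun a : ℂ => (-1 : ℂ) * a) = fun a => -(1 : ℂ) * a from rfl,
          map_neg_mul_eq_of_sum_eq_zero hα.card_eq hs]
        exact hcp
      · rw [← map_neg_mul_eq_of_sum_eq_zero hα.card_eq hs, show -(-1 : ℂ) = 1 by ring] at hcp
        exact hcp
      · exact hcp
    · -- λ ≠ 0 : both signs are read by inertness in L, hence agree
      have hiff : e = -1 ↔ e' = -1 := (hsign hs).trans hsign'.symm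
      have hee : e' = e := by
        rcases eq_or_eq_neg_of_sq_eq_one he with h1 | h1 <;>
          rcases eq_or_eq_neg_of_sq_eq_one he' with h2 | h2
        · rw [h1, h2]
        · exact absurd (hiff.mpr h2) (by rw [h1]; norm_num)
        · exact absurd (hiff.mp h1) (by rw [h2]; norm_num)
        · rw [h1, h2]
      rw [hee]
      exact hcp

end Summit.Langlands.Langlands.Cruxes.ShadowSignLaw.Birth

end
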